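/-
Origin: expansion seat `prover-pub-hodgecm-mc-sinst-1-g10-0`, handover #1253 2026-08-20T23:48Z md5 f8bfdfec5ac7 (106 l.; NEW additive DROP-ALONE leaf, ns HodgeCM.TwistedCoinv: congr_twist_apply, ker_congr_twist (ker (congr R (twist cW ρW)) χ = (ker ρW (χ * cW⁻¹)).map R), coinvCongrTwist (Coinv ρW (χ * cW⁻¹) ≃ₗ[k] Coinv (congr R (twist cW ρW)) χ, mk v ↦ mk (R v)) + coinvCongrTwist_mk / _symm_mk, commute_congr_twist, coinvCongrTwist_rep (intertwines twist cV (rep (χ * cW⁻¹) ρV hc) with rep χ (congr R (twist cV ρV)) _); NAMES for audit: HodgeCM.TwistedCoinv.ker_congr_twist · HodgeCM.TwistedCoinv.coinvCongrTwist_rep · HodgeCM.TwistedCoinv.coinvCongrTwist_symm_mk) (`HOME/mc/pub-hodgecm-mc-sinst-1-g10/stage67/HodgeCM/Model/AdelicThetaDistributionTwist.lean`, md5 f8bfdfec5ac7, 106 lines);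
landed by the gen-28 packager (p-g28) in gate run 67 as `HodgeCM/Model/AdelicThetaDistributionTwist.lean` (verbatim).
-/
/-
Copyright (c) 2026 the pub-hodgecm formalisation cell (harness21).  New file, not vendored.
Origin: session prover-pub-hodgecm-mc-sinst-1-g10-0 (unit pub-hodgecm-mc-sinst-1-g10, S-INSTANCE CONSTRUCTOR gen 10; DATUM SEAM 2, option (C) of
axioms-1-g16: functoriality of the `χ`-coinvariants along a linear equivalence of the carrier and a twist of the pair representation by characters), 2026-08-20.
Intended final place: `HodgeCM/Model/AdelicThetaDistributionTwist.lean` (NEW additive model-layer leaf; imports theta-3's `Model/WeilCentralCoinvariants` (#S14r2)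
and the vendored `RepresentationTheory/SeesawScalarCharacter`, `Automorphic/AdelicSchwartzBruhatTensor`; nothing imports it; drop alone).
-/
import Summits.HodgeConjecture.HodgeCM.Model.WeilCentralCoinvariants_3
import Literature.RepresentationTheory.SeesawScalarCharacter
import Literature.NumberTheory.Automorphic.AdelicSchwartzBruhatTensor

set_option autoImplicit false

/-!
# Coinvariants of a transported, character-twisted pair representation

Generic over a field `k`, groups `G`, `H`, a `k`-module `S` with commuting representations `ρV : G → End S`, `ρW : H → End S`, a linear
equivalence `R : S ≃ₗ[k] S'`, and characters `cV : G →* kˣ`, `cW : H →* kˣ`.  The TRANSPORTED TWISTED pair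
`ρV' := congr R (twist cV ρV)`, `ρW' := congr R (twist cW ρW)` (the shape of the honest finite Weil factor `finRepZero/One` of
`Model/AdelicThetaDistributionFin` over theta-3's `finPairRep`) has `χ`-coinvariants
* `ker_congr_twist` : `ker ρW' χ = (ker ρW (χ · cW⁻¹)).map R`;
* **`coinvCongrTwist … : Coinv ρW (χ · cW⁻¹) ≃ₗ[k] Coinv ρW' χ`**, `mk v ↦ mk (R v)` (`coinvCongrTwist_mk`);
* **`coinvCongrTwist_rep`** : it intertwines `twist cV (rep (χ · cW⁻¹) ρV)` with `rep χ ρV'` — so, as `k[G]`-modules, the coinvariants of the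
  transported twisted pair are the `cV`-TWIST of the coinvariants of the original pair at the character `χ · cW⁻¹` (axioms-1's option (C):
  «twist the splitting, not the dictionary» — the twisted record's Liu module is the honest slot's module).
KERNEL only: 0 records, 0 `def … : Prop`, nothing cited.
-/

noncomputable section

open Literature.RepresentationTheory (SeesawScalar.twist SeesawScalar.twist_apply)
open Literature.NumberTheory.Automorphic (Representation.congr Representation.congr_apply_apply)

namespace HodgeCM
namespace TwistedCoinv

variable {k : Type*} [Field k] {G H S S' : Type*} [Group G] [Group H] [AddCommGroup S] [Module k S] [AddCommGroup S'] [Module k S']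
variable (ρW : Representation k H S) (ρV : Representation k G S) (R : S ≃ₗ[k] S') (cV : G →* kˣ) (cW : H →* kˣ) (χ : H →* kˣ)

/-- the transported twisted representation on values `R v`. -/
theorem congr_twist_apply (ρ : Representation k H S) (c : H →* kˣ) (h : H) (v : S) :
    Representation.congr R (SeesawScalar.twist c ρ) h (R v) = ((c h : kˣ) : k) • R (ρ h v) := by
  rw [Representation.congr_apply_apply, SeesawScalar.twist_apply, map_smul]

/-- **The relation submodule of the transported twisted representation** is the image under `R` of the relation submodule of `ρW` at the
shifted character `χ · cW⁻¹`. -/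
theorem ker_congr_twist :
    ker (Representation.congr R (SeesawScalar.twist cW ρW)) χ = (ker ρW (χ * cW⁻¹)).map (R : S →ₗ[k] S') := by
  apply le_antisymm
  · -- generators `ρW' h v' - χ h • v'`, `v' = R v`
    rw [ker, Submodule.span_le]
    rintro _ ⟨⟨h, v'⟩, rfl⟩
    obtain ⟨v, rfl⟩ := R.surjective v'
    refine ⟨((cW h : kˣ) : k) • (ρW h v - (((χ * cW⁻¹) h : kˣ) : k) • v), ?_, ?_⟩
    · exact Submodule.smul_mem _ _ (sub_mem_ker ρW (χ * cW⁻¹) h v)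
    · simp only
      rw [congr_twist_apply, map_smul, map_sub, map_smul, smul_sub, smul_smul, MonoidHom.mul_apply, MonoidHom.inv_apply,
        Units.val_mul, ← mul_assoc,
        show ((cW h : kˣ) : k) * ((χ h : kˣ) : k) * (((cW h)⁻¹ : kˣ) : k) = ((χ h : kˣ) : k) by rw [mul_right_comm, Units.mul_inv, one_mul]]
      rfl
  · rw [Submodule.map_le_iff_le_comap, ker, Submodule.span_le]
    rintro _ ⟨⟨h, v⟩, rfl⟩
    simp only [SetLike.mem_coe, Submodule.mem_comap]
    have hmem := sub_mem_ker (Representation.congr R (SeesawScalar.twist cW ρW)) χ h (R v)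
    rw [congr_twist_apply] at hmem
    -- `cW h • R(ρW h v) - χ h • R v ∈ ker'` ⇒ multiply by `(cW h)⁻¹`
    have hmem' := Submodule.smul_mem _ (((cW h)⁻¹ : kˣ) : k) hmem
    rw [smul_sub, smul_smul, smul_smul, ← Units.val_mul, inv_mul_cancel, Units.val_one, one_smul] at hmem'
    rw [LinearEquiv.coe_coe, map_sub, map_smul, MonoidHom.mul_apply, MonoidHom.inv_apply, Units.val_mul, mul_comm]
    exact hmem'

/-- **The coinvariants of the transported twisted pair**: `Coinv ρW (χ · cW⁻¹) ≃ₗ Coinv (congr R (twist cW ρW)) χ`, `mk v ↦ mk (R v)`. -/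
def coinvCongrTwist : Coinv ρW (χ * cW⁻¹) ≃ₗ[k] Coinv (Representation.congr R (SeesawScalar.twist cW ρW)) χ :=
  Submodule.Quotient.equiv _ _ R (ker_congr_twist ρW R cW χ).symm

/-- (Ported verbatim from the HodgeCMPerL package; no docstring in the source.) -/
@[simp] theorem coinvCongrTwist_mk (v : S) :
    coinvCongrTwist ρW R cW χ (mk ρW (χ * cW⁻¹) v) = mk (Representation.congr R (SeesawScalar.twist cW ρW)) χ (R v) := rfl

/-- If `ρV`, `ρW` commute, so do their transported twists. -/
theorem commute_congr_twist (hc : ∀ (g : G) (h : H), Commute (ρV g) (ρW h)) (g : G) (h : H) :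
    Commute (Representation.congr R (SeesawScalar.twist cV ρV) g) (Representation.congr R (SeesawScalar.twist cW ρW) h) := by
  apply LinearMap.ext
  intro v'
  obtain ⟨v, rfl⟩ := R.surjective v'
  change Representation.congr R (SeesawScalar.twist cV ρV) g (Representation.congr R (SeesawScalar.twist cW ρW) h (R v)) =
    Representation.congr R (SeesawScalar.twist cW ρW) h (Representation.congr R (SeesawScalar.twist cV ρV) g (R v))
  rw [congr_twist_apply, map_smul, congr_twist_apply, congr_twist_apply, map_smul, congr_twist_apply, smul_comm,
    ← Module.End.mul_apply, (hc g h).eq, Module.End.mul_apply]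

/-- **`G`-compatibility**: `coinvCongrTwist` intertwines the `cV`-twist of `rep (χ · cW⁻¹) ρV` with `rep χ (congr R (twist cV ρV))`. -/
theorem coinvCongrTwist_rep (hc : ∀ (g : G) (h : H), Commute (ρV g) (ρW h)) (g : G) (x : Coinv ρW (χ * cW⁻¹)) :
    coinvCongrTwist ρW R cW χ (SeesawScalar.twist cV (rep (χ * cW⁻¹) ρV hc) g x) =
      rep χ (Representation.congr R (SeesawScalar.twist cV ρV)) (commute_congr_twist ρW ρV R cV cW hc) g
        (coinvCongrTwist ρW R cW χ x) := by
  obtain ⟨v, rfl⟩ := mk_surjective ρW (χ * cW⁻¹) x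
  rw [SeesawScalar.twist_apply, rep_mk, map_smul, coinvCongrTwist_mk, coinvCongrTwist_mk, rep_mk, congr_twist_apply, map_smul]

/-- The inverse direction on generators. -/
theorem coinvCongrTwist_symm_mk (v : S) :
    (coinvCongrTwist ρW R cW χ).symm (mk (Representation.congr R (SeesawScalar.twist cW ρW)) χ (R v)) = mk ρW (χ * cW⁻¹) v := by
  rw [LinearEquiv.symm_apply_eq, coinvCongrTwist_mk]

end TwistedCoinv
end HodgeCM

end
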